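import Literature.Geometry.Lorentzian.Genericity
import Literature.Geometry.Lorentzian.AsymptoticFlatness
import HarnessLib

/-!
# Tame finite-codimension genericity for asymptotically flat initial data (family `gr`)

Christodoulou's finite-codimension genericity (CQG **16** (1999) A23, p. A24; Ann. Math. **149**
(1999) 183, Thm. p. 187) is a statement inside a FIXED function space `𝓐` of initial data with
FIXED asymptotics: through every exceptional datum `α₀` passes a straight line
`𝓛_{α₀} = {α₀ + c f : c ∈ ℝ}`, `f ∈ 𝓐`, meeting the exceptional set only at `α₀`. The geometric
rendering `InitialDataSet.HasCodimAtLeastIn` / `InitialDataSet.IsChristodoulouGeneric` of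
`Genericity.lean` keeps only "jointly smooth injective curve of admissible data" and drops the
ambient space, its topology and the fixed end: joint smoothness of `(c, x) ↦ (h_c(x), k_c(x))` is a
condition local on compacta of `ℝᵐ × X`, so a family may differ from its base datum on a set
receding to spatial infinity as `c → 0`, with the asymptotically flat end and the ADM mass
re-chosen per member (semantic-vacuity audit 2026-08-16, §2.1 A/D: the "burial" of a datum in
the black-hole region of an exact Kerr slice of mass `M(c) → ∞` is a legal witness family).

This file restores the dropped uniformity WITHOUT putting a topology on the data type:

* `AFEnd.wDist e D D'`: the Dafermos–Rodnianski weighted `C² × C¹` distance of two data sets read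
  on the SAME end `e` (`sup_{m ≤ 2, ‖x‖ > R} ‖x‖^{1+m} ‖Dᵐ(h − h')(x)‖ +
  sup_{m ≤ 1, ‖x‖ > R} ‖x‖^{2+m} ‖Dᵐ(k − k')(x)‖`, the norm in which the DR class
  `h − (1 + 2M/r) δ = o₂(r⁻¹)`, `k = o₁(r⁻²)` (arXiv:0811.0354, App. B.2.3) is an affine space and
  in which the ADM mass is continuous), valued in `ℝ≥0∞` (an `iSup`; the value `∞` is allowed and
  simply fails every smallness demand);
* `InitialDataSet.IsTameDataFamily e m F`: a jointly smooth family all of whose members are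
  strongly asymptotically flat (DR rates) on the ONE fixed end `e`, which is the sole end of `X`,
  with a continuous mass function `c ↦ M(c)`, and which is continuous at `c = 0` in `e.wDist`;
* `InitialDataSet.IsImmersedAtZero m F`: the family is an immersion at the base point — for every
  parameter direction `v ≠ 0` some component `∂_v h_c(x)(u, w)` or `∂_v k_c(x)(u, w)` at `c = 0` is
  non-zero (the analogue of Christodoulou's linearly independent directions `f₁, …, fₘ`; for
  `m = 1`: the tangent `dF/dc (0)` is a non-zero jet field);
* `InitialDataSet.HasTameCodimAtLeastIn 𝓓 𝓔 m`, `InitialDataSet.IsTameChristodoulouGeneric 𝓓 P m`: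
  `HasCodimAtLeastIn` / `IsChristodoulouGeneric` with the witness family required to be tame on
  one end (chosen once per exceptional datum, NOT per member) and immersed at `0`.

The older, topology-free notions of `Genericity.lean` are kept (other files use them); the summit
`FinalStateConjecture` uses the tame notion.

## Design choices

* `wDist` is an extended-real `iSup` over the open chart region `{‖x‖ > e.R}` of the SAME end for
  both data sets; `hCoeff`/`kCoeff` carry junk values inside the closed ball, never sampled. A
  witness may always replace `e` by a collared restriction (larger `R`) so that the coefficients
  are smooth up to the inner sphere; the content of `Tendsto … (𝓝 0)` is at infinity.
* Continuity of the family at `c = 0` only (not on all of `ℝᵐ`): this is what ties `F c`, `c → 0`,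
  to the base datum `F 0 = d`; together with the weight `‖x‖¹` on `h − h'` it forces
  `M(c) → M(0)` (the leading terms differ by `2(M(c) − M(0))/r · δ`), which is what excludes
  receding modifications of divergent mass. Continuity of `M` is demanded explicitly as well
  (audit text), harmless for honest families.
* Immersion is measured on ALL of `X` through the scalar components `c ↦ h_c(x)(u, w)`,
  `c ↦ k_c(x)(u, w)` (plain `fderiv` on `ℝᵐ → ℝ`; no norm on the fibres of `TX` is needed), so that
  compactly supported perturbation directions `f` — Christodoulou's typical case — qualify.

## References

* D. Christodoulou, CQG 16 (1999) A23–A35, p. A24; Ann. Math. 149 (1999) 183–217, p. 187.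
* M. Dafermos, I. Rodnianski, *Lectures on black holes and linear waves*, arXiv:0811.0354,
  App. B.2.3 (the class `o₂(r⁻¹)`, `o₁(r⁻²)`).
-/

open Manifold Bundle TopologicalSpace Filter
open scoped ContDiff Topology ENNReal

noncomputable section

namespace Literature.Geometry.Lorentzian

/-! ### The weighted distance on one end -/

namespace AFEnd

variable {X : Type*} [TopologicalSpace X] [ChartedSpace E3 X] [IsManifold (𝓡 3) ∞ X]

/-- The **Dafermos–Rodnianski weighted `C² × C¹` distance** of two initial data sets `D`, `D'`
read in the chart of the SAME asymptotically flat end `e`: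
`sup_{m ≤ 2, ‖x‖ > R} ‖x‖^{1+m} ‖Dᵐ(hCoeff e D − hCoeff e D')(x)‖ +
 sup_{m ≤ 1, ‖x‖ > R} ‖x‖^{2+m} ‖Dᵐ(kCoeff e D − kCoeff e D')(x)‖`, valued in `ℝ≥0∞`. These are
the weights of the class `h = (1 + 2M/r) δ + o₂(r⁻¹)`, `k = o₁(r⁻²)`; two members of the class on
the same end are at finite distance iff their `o`-remainders are uniformly comparable, and the
leading terms contribute `2 |M − M'| ‖δ‖`. Dafermos–Rodnianski, arXiv:0811.0354, App. B.2.3;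
Christodoulou, CQG 16 (1999) A23, p. A24 (the fixed space `𝓐`). [cite: DafermosRodnianski2013, App. B.2.3] -/
def wDist (e : AFEnd X) (D D' : InitialDataSet (𝓡 3) X) : ℝ≥0∞ :=
  (⨆ (m : ℕ) (_ : m ≤ 2) (x : E3) (_ : e.R < ‖x‖),
      ENNReal.ofReal (‖x‖ ^ (1 + m)) *
        ‖iteratedFDeriv ℝ m (fun y ↦ hCoeff e D y - hCoeff e D' y) x‖ₑ) +
    ⨆ (m : ℕ) (_ : m ≤ 1) (x : E3) (_ : e.R < ‖x‖),
      ENNReal.ofReal (‖x‖ ^ (2 + m)) *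
        ‖iteratedFDeriv ℝ m (fun y ↦ kCoeff e D y - kCoeff e D' y) x‖ₑ

/-- The weighted distance of a data set to itself vanishes. [folklore] -/
theorem wDist_self (e : AFEnd X) (D : InitialDataSet (𝓡 3) X) : e.wDist D D = 0 := by
  have h₁ : (fun y ↦ hCoeff e D y - hCoeff e D y) = fun _ ↦ 0 :=
    funext fun y ↦ sub_self (G := E3 →L[ℝ] E3 →L[ℝ] ℝ) (hCoeff e D y)
  have h₂ : (fun y ↦ kCoeff e D y - kCoeff e D y) = fun _ ↦ 0 :=
    funext fun y ↦ sub_self (G := E3 →L[ℝ] E3 →L[ℝ] ℝ) (kCoeff e D y)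
  simp [wDist, h₁, h₂]

end AFEnd

/-! ### Tame families and tame finite codimension -/

namespace InitialDataSet

section Immersion

variable {E : Type*} [NormedAddCommGroup E] [NormedSpace ℝ E] {H : Type*} [TopologicalSpace H]
  {I : ModelWithCorners ℝ E H} {X : Type*} [TopologicalSpace X] [ChartedSpace H X]
  [IsManifold I ∞ X]

/-- The `m`-parameter family `F : ℝᵐ → InitialDataSet I X` is **immersed at the base point `0`**:
for every parameter direction `v ≠ 0` there are a point `x ∈ X` and tangent vectors `u, w` at `x`
such that the directional derivative at `c = 0` of one of the scalar components
`c ↦ h_c(x)(u, w)`, `c ↦ k_c(x)(u, w)` in the direction `v` is non-zero — i.e. the tangent map of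
`c ↦ (h_c, k_c)` at `0` is injective on `ℝᵐ` (for `m = 1`: the `c`-derivative of the family at
`0` is a non-zero jet field). This renders the linear independence of Christodoulou's directions
`f₁, …, fₘ` in `α₀ + ∑ cᵢ fᵢ` (Ann. Math. 149 (1999) 183, Thm. p. 187: "the family
`α₀ + λ₁ f₁ + λ₂ f₂`"; CQG 16 (1999) A23, p. A24) for curved families; without it stalled or
zig-zag curves through the base datum would qualify. [cite: Christodoulou1999, p. A24] -/
def IsImmersedAtZero (m : ℕ) (F : EuclideanSpace ℝ (Fin m) → InitialDataSet I X) : Prop :=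
  ∀ v : EuclideanSpace ℝ (Fin m), v ≠ 0 →
    ∃ (x : X) (u w : TangentSpace I x),
      fderiv ℝ (fun c ↦ (F c).h.inner x u w) 0 v ≠ 0 ∨ fderiv ℝ (fun c ↦ (F c).k x u w) 0 v ≠ 0

/-- A constant family is not immersed at `0` as soon as `m ≥ 1` (all parameter derivatives
vanish). [folklore] -/
theorem not_isImmersedAtZero_const {m : ℕ} (hm : m ≠ 0) (d : InitialDataSet I X) :
    ¬ IsImmersedAtZero m (fun _ : EuclideanSpace ℝ (Fin m) ↦ d) := by
  intro h
  obtain ⟨x, u, w, huw⟩ := h (EuclideanSpace.single ⟨0, Nat.pos_of_ne_zero hm⟩ 1)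
    (by simp)
  simp at huw

end Immersion

variable {X : Type*} [TopologicalSpace X] [ChartedSpace E3 X] [IsManifold (𝓡 3) ∞ X]

/-- The `m`-parameter family `F : ℝᵐ → InitialDataSet (𝓡 3) X` is **tame on the end `e`**: it is
jointly smooth (`IsSmoothDataFamily`); `e` is the sole end of `X` (`AFEnd.IsSoleEnd`); EVERY
member is strongly asymptotically flat with Dafermos–Rodnianski rates on this SAME end,
`h_c = (1 + 2M(c)/r) δ + o₂(r⁻¹)`, `k_c = o₁(r⁻²)`, with a CONTINUOUS mass function `c ↦ M(c)`;
and the family is continuous at the base parameter in the weighted `C² × C¹` distance of the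
end, `e.wDist (F c) (F 0) → 0` as `c → 0`. This is the uniformity carried by Christodoulou's fixed
function space `𝓐` of data with fixed asymptotics (CQG 16 (1999) A23, p. A24; Ann. Math. 149
(1999) 183, p. 187: lines `α₀ + c f`, `f ∈ 𝓐`), in the Dafermos–Rodnianski class
(arXiv:0811.0354, App. B.2.3); it excludes families whose members differ from the base datum on
sets receding to infinity with divergent mass. [cite: Christodoulou1999, p. A24] -/
def IsTameDataFamily (e : AFEnd X) (m : ℕ)
    (F : EuclideanSpace ℝ (Fin m) → InitialDataSet (𝓡 3) X) : Prop :=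
  IsSmoothDataFamily m F ∧ e.IsSoleEnd ∧
    (∃ M : EuclideanSpace ℝ (Fin m) → ℝ,
      Continuous M ∧ ∀ c, e.IsStronglyAsymptoticallyFlatDR (F c) (M c)) ∧
    Tendsto (fun c ↦ e.wDist (F c) (F 0)) (𝓝 0) (𝓝 0)

/-- **Christodoulou's finite codimension, tame relative version.** A set `𝓔` of initial data
sets on the `3`-manifold `X` **has tame codimension at least `m` inside the admissible class
`𝓓`** if for every `d ∈ 𝓔` there are ONE asymptotically flat end `e` of `X` and an
`m`-parameter family `F` of data in `𝓓`, tame on `e` (`IsTameDataFamily`), immersed at `0`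
(`IsImmersedAtZero`), injective, with `F 0 = d`, meeting `𝓔` only at the parameter `0`. The end
is fixed once for the whole family through `d` (not re-chosen per member). Christodoulou, CQG 16
(1999) A23–A35, p. A24; Ann. Math. 149 (1999) 183–217, p. 187; weights of Dafermos–Rodnianski,
arXiv:0811.0354, App. B.2.3. [cite: Christodoulou1999, p. A24] -/
def HasTameCodimAtLeastIn (𝓓 𝓔 : Set (InitialDataSet (𝓡 3) X)) (m : ℕ) : Prop :=
  ∀ d ∈ 𝓔, ∃ (e : AFEnd X) (F : EuclideanSpace ℝ (Fin m) → InitialDataSet (𝓡 3) X),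
    IsTameDataFamily e m F ∧ IsImmersedAtZero m F ∧ F 0 = d ∧ Function.Injective F ∧
      (∀ c, F c ∈ 𝓓) ∧ ∀ c ≠ 0, F c ∉ 𝓔

/-- A property `P` of admissible data (`𝓓` the admissible class) is **generic in the sense of
Christodoulou with tame codimension `m`** if its exceptional set `{d ∈ 𝓓 | ¬ P d}` has tame
codimension at least `m` inside `𝓓` (`HasTameCodimAtLeastIn`): through every exceptional datum
passes an injective `m`-parameter family of admissible data, tame on one fixed asymptotically
flat end and immersed at the base point, all of whose other members satisfy `P`. Christodoulou's
formulation of cosmic censorship / the final state problem asks for `m = 1`. Christodoulou,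
CQG 16 (1999) A23–A35, p. A24; Ann. Math. 149 (1999) 183–217, p. 187. [cite: Christodoulou1999, p. A24] -/
def IsTameChristodoulouGeneric (𝓓 : Set (InitialDataSet (𝓡 3) X))
    (P : InitialDataSet (𝓡 3) X → Prop) (m : ℕ) : Prop :=
  HasTameCodimAtLeastIn 𝓓 {d ∈ 𝓓 | ¬ P d} m

/-- A tame family is in particular a smooth family. [folklore] -/
theorem IsTameDataFamily.isSmoothDataFamily {e : AFEnd X} {m : ℕ}
    {F : EuclideanSpace ℝ (Fin m) → InitialDataSet (𝓡 3) X} (h : IsTameDataFamily e m F) :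
    IsSmoothDataFamily m F :=
  h.1

/-- Tame relative codimension implies the topology-free relative codimension of
`Genericity.lean` (forget the end, tameness and immersion). [folklore] -/
theorem HasTameCodimAtLeastIn.hasCodimAtLeastIn {𝓓 𝓔 : Set (InitialDataSet (𝓡 3) X)} {m : ℕ}
    (h : HasTameCodimAtLeastIn 𝓓 𝓔 m) : HasCodimAtLeastIn 𝓓 𝓔 m := by
  intro d hd
  obtain ⟨e, F, hF, -, h0, hinj, hD, hE⟩ := h d hd
  exact ⟨F, hF.1, h0, hinj, hD, hE⟩

/-- Tame Christodoulou genericity implies the topology-free notion of `Genericity.lean`. [folklore] -/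
theorem IsTameChristodoulouGeneric.isChristodoulouGeneric {𝓓 : Set (InitialDataSet (𝓡 3) X)}
    {P : InitialDataSet (𝓡 3) X → Prop} {m : ℕ} (h : IsTameChristodoulouGeneric 𝓓 P m) :
    IsChristodoulouGeneric 𝓓 P m :=
  HasTameCodimAtLeastIn.hasCodimAtLeastIn h

/-- An exceptional set of positive tame codimension lies in the admissible class. [folklore] -/
theorem HasTameCodimAtLeastIn.subset {𝓓 𝓔 : Set (InitialDataSet (𝓡 3) X)} {m : ℕ}
    (h : HasTameCodimAtLeastIn 𝓓 𝓔 m) : 𝓔 ⊆ 𝓓 :=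
  h.hasCodimAtLeastIn.subset

/-- A constant family on a sole, strongly asymptotically flat end is tame (anti-vacuity of the
typing: tameness alone is satisfiable; it is injectivity/immersion that exclude constant
families). [folklore] -/
theorem isTameDataFamily_const {e : AFEnd X} (he : e.IsSoleEnd) (m : ℕ)
    {d : InitialDataSet (𝓡 3) X} {M : ℝ} (hd : e.IsStronglyAsymptoticallyFlatDR d M) :
    IsTameDataFamily e m (fun _ : EuclideanSpace ℝ (Fin m) ↦ d) := by
  refine ⟨isSmoothDataFamily_const m d, he, ⟨fun _ ↦ M, continuous_const, fun _ ↦ hd⟩, ?_⟩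
  simp only [AFEnd.wDist_self]
  exact tendsto_const_nhds

/-- The empty exceptional set has every tame codimension: a property that holds for all
admissible data is tame-Christodoulou-generic for every `m`. [folklore] -/
theorem isTameChristodoulouGeneric_of_forall {𝓓 : Set (InitialDataSet (𝓡 3) X)}
    {P : InitialDataSet (𝓡 3) X → Prop} (hP : ∀ d ∈ 𝓓, P d) (m : ℕ) :
    IsTameChristodoulouGeneric 𝓓 P m := by
  intro d hd
  exact absurd (hP d hd.1) hd.2

end InitialDataSet

end Literature.Geometry.Lorentzian

end
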